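import Literature.Analysis.FluidPDE.KatoLaiAbstractEvolution
import Literature.Analysis.ODE.PeanoExistence
import Mathlib.Analysis.InnerProductSpace.Calculus
import Mathlib.Analysis.InnerProductSpace.PiL2
import Mathlib.Analysis.Calculus.MeanValue
import HarnessLib

/-!
# Kato–Lai 1984, Theorem A — Step 1 of the proof: the Galerkin approximations

Topic `Literature/Analysis/FluidPDE`. Source: T. Kato, C. Y. Lai, *Nonlinear evolution equations
and the Euler flow*, J. Funct. Anal. **56** (1984) 15–28, §8, Step 1 (p. 26). This file proves the
finite-dimensional step of the proof of `Literature.Analysis.FluidPDE.KatoLai1984_thmA`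
(`KatoLaiAbstractEvolution.lean`): for an admissible triplet `{V, H, X}`, a sequentially weakly
continuous `A : I_{T₀} × H → X` with `⟨v, A(t, v)⟩ ≥ −β(‖v‖²_H)` on `V`, a finite family
`e₁, …, e_m ∈ V` orthonormal in `H` spanning `M`, and a strict supersolution `p` of `p' = 2β(p)`
with `p(0) ≥ ‖φ‖²`, the Galerkin system

  `dₜu + P A(t, u) = 0`, `u(t) ∈ M`, `u(0) = Pφ`, `Pf = Σ_j ⟨e_j, f⟩ e_j` (8.2), (8.4)

has a solution on the whole of `I_T` with `‖u(t)‖²_H ≤ p(t)` (printed: "`‖u(t)‖²` is majorized by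
`p(t)` … and `u(t)` can be extended as a solution of (8.4) to all `t ∈ I_T`";
`KatoLai.galerkin_exists`).

## Proof rendered

In the coordinates `c_i = (e_i | u)_H` the system is the ODE `c' = G(t, c)`,
`G_i(t, c) = −⟨e_i, A(t, Σ_j c_j e_j)⟩` on `ℝ^m = EuclideanSpace ℝ (Fin m)`; `G` is continuous
because strong convergence in `ℝ^m` gives weak convergence of `Σ c_j e_j` in `H`, and `A` is
sequentially weakly continuous (`KatoLai.continuous_galerkinField`). Peano's theorem
(`Literature.Analysis.ODE.exists_hasDerivWithinAt_of_continuous_of_norm_le`, applied to `G`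
composed with the retractions onto `I_T` and onto a ball of radius `ρ`, `ρ² > sup p`) gives a
global solution of the truncated system; the energy identity
`dₜ‖c‖² = 2(c | G(t, c)) = −2⟨u, A(t, u)⟩ ≤ 2β(‖c‖²)` (by (8.3), (3.2) and `Pu = u`) holds as long
as `‖c‖ ≤ ρ`, and the comparison lemma `KatoLai.le_of_hasDerivWithinAt_of_eq_imp_lt` (a strict
supersolution cannot be touched from below; Mathlib's fencing theorem
`image_le_of_deriv_right_lt_deriv_boundary'`) shows `‖c(t)‖² ≤ p(t) < ρ²` on `I_T`, so the
truncation is never active and `c` solves the Galerkin system itself. The printed proof invokes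
Peano's theorem on `M` and extends the local solution using the bound; truncation-then-comparison
is the same argument with the continuation packaged into the global form of Peano's theorem.

Mathlib/tree search: the comparison step is Mathlib's `image_le_of_deriv_right_lt_deriv_boundary'`
(wrapped as `KatoLai.le_of_hasDerivWithinAt_of_eq_imp_lt`); Peano's theorem is the tree's
`Literature.Analysis.ODE.exists_hasDerivWithinAt_of_continuous_of_norm_le` (Mathlib has only
Picard–Lindelöf); `lean search galerkin` finds only the torus/Fourier-specific `Torus.galerkin*`
material (`NSGalerkin*`, `EnergySpaceTorus`), nothing for an abstract triplet; used from Mathlib: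
`HasDerivWithinAt.norm_sq`, `Orthonormal.inner_sum`, `Orthonormal.sum_inner_products_le` (Bessel),
`EuclideanSpace.proj`, `IsCompact.exists_bound_of_continuousOn`, `continuous_iff_seqContinuous`.

## References

* T. Kato, C. Y. Lai, J. Funct. Anal. 56 (1984), §8 Step 1, p. 26. [cite: KatoLai1984, §8 Step 1 (p. 26)]
* P. Hartman, *Ordinary Differential Equations*, SIAM 2002, Thm II.2.1 (Peano).
-/

noncomputable section

open Set Filter Topology Metric Function
open scoped RealInnerProductSpace

namespace Literature.Analysis.FluidPDE

namespace KatoLai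

/-! ### A strict supersolution cannot be touched from below -/

/-- **Comparison with a strict supersolution.** Let `q, p` be differentiable within `[0, T]` with
`q(0) ≤ p(0)`, and suppose that at every point where `q = p` one has `q' < p'`. Then `q ≤ p` on
`[0, T]`. This is the comparison behind "‖u(t)‖² is majorized by `p(t)`" in Kato–Lai's Step 1, and
a thin wrapper (two-sided derivatives on `Icc` restricted to right derivatives on `Ico`) around
Mathlib's fencing theorem `image_le_of_deriv_right_lt_deriv_boundary'`
(`Mathlib/Analysis/Calculus/MeanValue.lean`). [folklore] -/
theorem le_of_hasDerivWithinAt_of_eq_imp_lt {q p q' p' : ℝ → ℝ} {T : ℝ}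
    (hq : ∀ t ∈ Icc 0 T, HasDerivWithinAt q (q' t) (Icc 0 T) t)
    (hp : ∀ t ∈ Icc 0 T, HasDerivWithinAt p (p' t) (Icc 0 T) t) (h0 : q 0 ≤ p 0)
    (hlt : ∀ t ∈ Icc 0 T, q t = p t → q' t < p' t) : ∀ t ∈ Icc 0 T, q t ≤ p t :=
  fun _ ht => image_le_of_deriv_right_lt_deriv_boundary' (fun t ht => (hq t ht).continuousWithinAt)
    (fun t ht => (hq t (Ico_subset_Icc_self ht)).mono_of_mem_nhdsWithin
      (Filter.mem_of_superset (Icc_mem_nhdsGE ht.2) (Icc_subset_Icc_left ht.1)))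
    h0 (fun t ht => (hp t ht).continuousWithinAt)
    (fun t ht => (hp t (Ico_subset_Icc_self ht)).mono_of_mem_nhdsWithin
      (Filter.mem_of_superset (Icc_mem_nhdsGE ht.2) (Icc_subset_Icc_left ht.1)))
    (fun t ht => hlt t (Ico_subset_Icc_self ht)) ht

/-! ### The Galerkin system in coordinates -/

universe u v w

variable {V : Type u} {H : Type v} {X : Type w}
  [NormedAddCommGroup V] [NormedSpace ℝ V] [NormedAddCommGroup H] [InnerProductSpace ℝ H]
  [NormedAddCommGroup X] [NormedSpace ℝ X]

section Defs

variable (𝒯 : AdmissibleTriplet V H X) (A : ℝ → H → X) {m : ℕ} (e : Fin m → V)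

/-- The Galerkin trial vector `Σ_i c_i e_i ∈ V` with coordinates `c ∈ ℝ^m`
(Kato–Lai 1984, (8.1)). [cite: KatoLai1984, §8 Step 1, (8.1) (p. 26)] -/
def galerkinVec (c : EuclideanSpace ℝ (Fin m)) : V :=
  ∑ i, c i • e i

/-- The Galerkin trial vector seen in `H`: `Σ_i c_i e_i` (Kato–Lai 1984, (8.1)). [cite: KatoLai1984, §8 Step 1, (8.1) (p. 26)] -/
def galerkinLift (c : EuclideanSpace ℝ (Fin m)) : H :=
  ∑ i, c i • 𝒯.inclVH (e i)

/-- The **Galerkin vector field** in coordinates: `G_i(t, c) = −⟨e_i, A(t, Σ_j c_j e_j)⟩`, i.e.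
`−PA(t, u)` of (8.4) with `Pf = Σ_j ⟨e_j, f⟩ e_j` (8.2). [cite: KatoLai1984, §8 Step 1, (8.2)–(8.4) (p. 26)] -/
def galerkinField (t : ℝ) (c : EuclideanSpace ℝ (Fin m)) : EuclideanSpace ℝ (Fin m) :=
  WithLp.toLp 2 fun i => -(𝒯.pairing (e i) (A t (galerkinLift 𝒯 e c)))

end Defs

section Galerkin

variable {𝒯 : AdmissibleTriplet V H X} {A : ℝ → H → X} {m : ℕ} {e : Fin m → V}

/-- `Σ c_i e_i` in `H` is the image of `Σ c_i e_i ∈ V`. [cite: KatoLai1984, §8 Step 1 (p. 26)] -/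
theorem inclVH_galerkinVec (c : EuclideanSpace ℝ (Fin m)) :
    𝒯.inclVH (galerkinVec e c) = galerkinLift 𝒯 e c := by
  simp [galerkinVec, galerkinLift, map_sum, map_smul]

/-- The lift `c ↦ Σ c_i e_i` is continuous. [folklore] -/
theorem continuous_galerkinLift : Continuous (galerkinLift 𝒯 e) := by
  unfold galerkinLift
  refine continuous_finsetSum _ fun i _ => ?_
  exact ((EuclideanSpace.proj i).continuous).smul continuous_const

/-- The coordinates are recovered by pairing with the orthonormal family: `(e_i | Σ c_j e_j) = c_i`
(Kato–Lai 1984, (8.1)). [cite: KatoLai1984, §8 Step 1, (8.1) (p. 26)] -/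
theorem inner_galerkinLift (he : Orthonormal ℝ (𝒯.inclVH ∘ e)) (c : EuclideanSpace ℝ (Fin m))
    (i : Fin m) : ⟪𝒯.inclVH (e i), galerkinLift 𝒯 e c⟫ = c i :=
  he.inner_right_fintype (fun j => c j) i

/-- The lift is an isometry onto its image: `‖Σ c_i e_i‖²_H = ‖c‖²` (orthonormality). [cite: KatoLai1984, §8 Step 1 (p. 26)] -/
theorem norm_galerkinLift_sq (he : Orthonormal ℝ (𝒯.inclVH ∘ e)) (c : EuclideanSpace ℝ (Fin m)) :
    ‖galerkinLift 𝒯 e c‖ ^ 2 = ‖c‖ ^ 2 := by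
  rw [← real_inner_self_eq_norm_sq, galerkinLift]
  have := he.inner_sum (fun j => c j) (fun j => c j) Finset.univ
  simp only [Function.comp_apply, conj_trivial] at this
  rw [this, EuclideanSpace.real_norm_sq_eq]
  exact Finset.sum_congr rfl fun i _ => by ring

/-- **(8.3) with (3.2) in coordinates**: `(c | G(t, c)) = −⟨Σ c_i e_i, A(t, Σ c_i e_i)⟩`, the
identity `(u | PA(t, u))_H = ⟨u, A(t, u)⟩` for `u ∈ M` behind the energy estimate of Step 1. [cite: KatoLai1984, §8 Step 1, (8.3) (p. 26)] -/
theorem inner_galerkinField (t : ℝ) (c : EuclideanSpace ℝ (Fin m)) :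
    ⟪c, galerkinField 𝒯 A e t c⟫ =
      -(𝒯.pairing (galerkinVec e c) (A t (galerkinLift 𝒯 e c))) := by
  have h1 : 𝒯.pairing (galerkinVec e c) (A t (galerkinLift 𝒯 e c)) =
      ∑ i, c i * 𝒯.pairing (e i) (A t (galerkinLift 𝒯 e c)) := by
    simp [galerkinVec, map_sum, map_smul]
  rw [h1, galerkinField, PiLp.inner_apply, ← Finset.sum_neg_distrib]
  refine Finset.sum_congr rfl fun i _ => ?_
  rw [PiLp.toLp_apply, RCLike.inner_apply, conj_trivial]
  ring

/-- **Continuity of the Galerkin field** on `I × ℝ^m` when `A` is sequentially weakly continuous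
on `I × H`: strong convergence `c_n → c` in `ℝ^m` gives strong, hence weak, convergence of
`Σ c_{n,j} e_j` in `H`, so `⟨e_i, A(t_n, ·)⟩ → ⟨e_i, A(t, ·)⟩` coordinatewise ("(8.4) is an ordinary
differential equation with `PA(t, u)` continuous on `I_{T₀} × M` into `M`", p. 26). Stated for the
field with the time variable clamped to `[0, T] ⊆ I` by `Set.projIcc`. [cite: KatoLai1984, §8 Step 1 (p. 26)] -/
theorem continuous_galerkinField {S : Set ℝ} (hA : IsSeqWeaklyContinuousOn S A) {T : ℝ}
    (hT : 0 ≤ T) (hST : Icc 0 T ⊆ S) :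
    Continuous fun z : ℝ × EuclideanSpace ℝ (Fin m) =>
      galerkinField 𝒯 A e (projIcc 0 T hT z.1) z.2 := by
  -- reduce to the coordinates
  have hcoord : ∀ i : Fin m, Continuous fun z : ℝ × EuclideanSpace ℝ (Fin m) =>
      𝒯.pairing (e i) (A (projIcc 0 T hT z.1) (galerkinLift 𝒯 e z.2)) := by
    intro i
    refine continuous_iff_seqContinuous.2 fun z zℓ hz => ?_
    have h1 : Tendsto (fun n => (projIcc 0 T hT (z n).1 : ℝ)) atTop (𝓝 (projIcc 0 T hT zℓ.1)) :=
      ((continuous_subtype_val.comp continuous_projIcc).tendsto _).comp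
        ((continuous_fst.tendsto _).comp hz)
    have h2 : Tendsto (fun n => galerkinLift 𝒯 e (z n).2) atTop (𝓝 (galerkinLift 𝒯 e zℓ.2)) :=
      (continuous_galerkinLift.tendsto _).comp ((continuous_snd.tendsto _).comp hz)
    have h3 : ∀ h : H, Tendsto (fun n => ⟪h, galerkinLift 𝒯 e (z n).2⟫) atTop
        (𝓝 ⟪h, galerkinLift 𝒯 e zℓ.2⟫) := fun h =>
      ((continuous_const.inner continuous_id).tendsto _).comp h2
    exact hA _ _ _ _ (fun n => hST (projIcc 0 T hT (z n).1).2) (hST (projIcc 0 T hT zℓ.1).2)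
      h1 h3 (𝒯.pairing (e i))
  have h : Continuous fun z : ℝ × EuclideanSpace ℝ (Fin m) => fun i : Fin m =>
      -(𝒯.pairing (e i) (A (projIcc 0 T hT z.1) (galerkinLift 𝒯 e z.2))) :=
    continuous_pi fun i => (hcoord i).neg
  exact (PiLp.continuous_toLp 2 _).comp h

/-- The coordinate functional `c ↦ c_i` composed with a curve: derivative of a coordinate.
[folklore] -/
theorem hasDerivWithinAt_coord {c : ℝ → EuclideanSpace ℝ (Fin m)} {c' : EuclideanSpace ℝ (Fin m)}
    {s : Set ℝ} {t : ℝ} (hc : HasDerivWithinAt c c' s t) (i : Fin m) :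
    HasDerivWithinAt (fun τ => c τ i) (c' i) s t := by
  have h := ((EuclideanSpace.proj (𝕜 := ℝ) i).hasFDerivAt.comp_hasDerivWithinAt t hc)
  simpa [Function.comp_def] using h

/-- **Kato–Lai 1984, proof of Theorem A, Step 1** (p. 26): the Galerkin system (8.4) on the span
`M` of an `H`-orthonormal family `e₁, …, e_m ∈ V` has a solution on all of `I_T = [0, T]`,
`T ≤ T₀`, with `‖u(t)‖²_H ≤ p(t)` for every strict supersolution `p` (`p(0) ≥ ‖φ‖²`,
`p' > 2β(p)`): there is a continuous `u : I_T → M ⊂ H` with `u(0) = Pφ = Σ (e_i | φ) e_i`,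
`‖u(t)‖² ≤ p(t)`, and `dₜ(e_i | u(t)) = −⟨e_i, A(t, u(t))⟩` for each `i` (the coordinates of
`dₜu + PA(t, u) = 0`). Ingredients: Peano's theorem for the truncated coordinate field
(`Literature.Analysis.ODE.exists_hasDerivWithinAt_of_continuous_of_norm_le`), the energy identity
`dₜ‖u‖² = −2⟨u, A(t, u)⟩ ≤ 2β(‖u‖²)` ((8.3), (3.2), `Pu = u`) and the comparison lemma
`le_of_hasDerivWithinAt_of_eq_imp_lt`. [cite: KatoLai1984, §8 Step 1 (p. 26)] -/
theorem galerkin_exists (𝒯 : AdmissibleTriplet V H X) {T₀ : ℝ} {A : ℝ → H → X} {β : ℝ → ℝ}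
    (hA : IsSeqWeaklyContinuousOn (Icc 0 T₀) A)
    (hcoercive : ∀ t ∈ Icc 0 T₀, ∀ v : V,
      -β (‖𝒯.inclVH v‖ ^ 2) ≤ 𝒯.pairing v (A t (𝒯.inclVH v)))
    (φ : H) {T : ℝ} (hT : 0 < T) (hTT₀ : T ≤ T₀) {p p' : ℝ → ℝ}
    (hp : ∀ t ∈ Icc 0 T, HasDerivWithinAt p (p' t) (Icc 0 T) t) (hp0 : ‖φ‖ ^ 2 ≤ p 0)
    (hsuper : ∀ t ∈ Icc 0 T, 2 * β (p t) < p' t) {m : ℕ} (e : Fin m → V)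
    (he : Orthonormal ℝ (𝒯.inclVH ∘ e)) :
    ∃ u : ℝ → H, ContinuousOn u (Icc 0 T) ∧ u 0 = ∑ i, ⟪𝒯.inclVH (e i), φ⟫ • 𝒯.inclVH (e i) ∧
      (∀ t ∈ Icc 0 T, ‖u t‖ ^ 2 ≤ p t) ∧
      (∀ t, u t ∈ Submodule.span ℝ (Set.range (𝒯.inclVH ∘ e))) ∧
      ∀ i : Fin m, ∀ t ∈ Icc 0 T, HasDerivWithinAt (fun s => ⟪𝒯.inclVH (e i), u s⟫)
        (-(𝒯.pairing (e i) (A t (u t)))) (Icc 0 T) t := by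
  have hIcc : Icc 0 T ⊆ Icc 0 T₀ := Icc_subset_Icc le_rfl hTT₀
  -- a bound `P` for `p` on `[0, T]` and the truncation radius `ρ`, `ρ² = P + 1`
  have hpc : ContinuousOn p (Icc 0 T) := fun t ht => (hp t ht).continuousWithinAt
  obtain ⟨P, hP⟩ : ∃ P, ∀ t ∈ Icc 0 T, p t ≤ P := by
    obtain ⟨P, hP⟩ := isCompact_Icc.bddAbove_image hpc
    exact ⟨P, fun t ht => hP (mem_image_of_mem p ht)⟩
  have hP0 : 0 ≤ P := ((sq_nonneg _).trans hp0).trans (hP 0 ⟨le_rfl, hT.le⟩)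
  set ρ : ℝ := Real.sqrt (P + 1) with hρ
  have hρpos : 0 < ρ := Real.sqrt_pos.2 (by linarith)
  have hρsq : ρ ^ 2 = P + 1 := Real.sq_sqrt (by linarith)
  -- the truncated field, continuous and bounded on `ℝ × ℝ^m`
  set π : EuclideanSpace ℝ (Fin m) → EuclideanSpace ℝ (Fin m) := ODE.ballRetraction 0 ρ with hπ
  set G : ℝ → EuclideanSpace ℝ (Fin m) → EuclideanSpace ℝ (Fin m) :=
    fun t c => galerkinField 𝒯 A e (projIcc 0 T hT.le t) (π c) with hG
  have hGc : Continuous (uncurry G) := by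
    have h1 := continuous_galerkinField (𝒯 := 𝒯) (e := e) hA hT.le hIcc
    have h2 : Continuous fun z : ℝ × EuclideanSpace ℝ (Fin m) => (z.1, π z.2) :=
      continuous_fst.prodMk ((ODE.continuous_ballRetraction hρpos).comp continuous_snd)
    exact h1.comp h2
  set K : Set (ℝ × EuclideanSpace ℝ (Fin m)) := Icc 0 T ×ˢ closedBall 0 ρ with hK
  have hKc : IsCompact K := isCompact_Icc.prod (isCompact_closedBall 0 ρ)
  obtain ⟨Mb, hMb⟩ := hKc.exists_bound_of_continuousOn hGc.continuousOn
  have hGM : ∀ t c, ‖G t c‖ ≤ Mb := by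
    intro t c
    have hmem : ((projIcc 0 T hT.le t : ℝ), π c) ∈ K :=
      ⟨(projIcc 0 T hT.le t).2, ODE.ballRetraction_mem hρpos c⟩
    have heq : G t c = uncurry G ((projIcc 0 T hT.le t : ℝ), π c) := by
      simp only [hG, uncurry_apply_pair, projIcc_val hT.le,
        hπ, ODE.ballRetraction_of_mem hρpos (ODE.ballRetraction_mem hρpos c)]
    rw [heq]
    exact hMb _ hmem
  -- Peano: a global solution of the truncated system
  set c₀ : EuclideanSpace ℝ (Fin m) := WithLp.toLp 2 fun i => ⟪𝒯.inclVH (e i), φ⟫ with hc₀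
  obtain ⟨c, hc0, -, hcd⟩ :=
    ODE.exists_hasDerivWithinAt_of_continuous_of_norm_le hGc hGM 0 c₀ T
  rw [zero_add] at hcd
  -- energy: `q = ‖c‖²`, `q' = 2 (c | G(t, c))`
  set q : ℝ → ℝ := fun t => ‖c t‖ ^ 2 with hq
  have hqd : ∀ t ∈ Icc 0 T, HasDerivWithinAt q (2 * ⟪c t, G t (c t)⟫) (Icc 0 T) t := by
    intro t ht
    exact (hcd t ht).norm_sq
  have hq0 : q 0 ≤ p 0 := by
    -- `‖Pφ‖ ≤ ‖φ‖`: Bessel's inequality for the orthonormal family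
    have hB := he.sum_inner_products_le φ (s := Finset.univ)
    have h1 : q 0 = ∑ i, ⟪𝒯.inclVH (e i), φ⟫ ^ 2 := by
      simp only [hq, hc0, hc₀, EuclideanSpace.real_norm_sq_eq, PiLp.toLp_apply]
    have h2 : ∑ i, ⟪𝒯.inclVH (e i), φ⟫ ^ 2 ≤ ‖φ‖ ^ 2 := by
      simpa only [Function.comp_apply, Real.norm_eq_abs, sq_abs] using hB
    linarith
  -- at a touching point the truncation is inactive and the energy inequality is strict
  have htouch : ∀ t ∈ Icc 0 T, q t = p t → 2 * ⟪c t, G t (c t)⟫ < p' t := by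
    intro t ht hqt
    have hnorm : ‖c t‖ ≤ ρ := by
      have h1 : ‖c t‖ ^ 2 ≤ ρ ^ 2 := by
        rw [hρsq]; have := hP t ht; simp only [hq] at hqt; linarith
      exact (sq_le_sq₀ (norm_nonneg _) hρpos.le).1 h1
    have hπc : π (c t) = c t := ODE.ballRetraction_of_mem hρpos (by simpa using hnorm)
    have hGt : G t (c t) = galerkinField 𝒯 A e t (c t) := by
      simp only [hG, projIcc_of_mem hT.le ht, hπc]
    rw [hGt, inner_galerkinField]
    have hco := hcoercive t (hIcc ht) (galerkinVec e (c t))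
    rw [inclVH_galerkinVec, norm_galerkinLift_sq he] at hco
    have hβq : β (‖c t‖ ^ 2) = β (p t) := by simp only [hq] at hqt; rw [hqt]
    have := hsuper t ht
    rw [hβq] at hco
    linarith
  -- comparison: `‖c(t)‖² ≤ p(t)` on `[0, T]`, so the truncation is never active
  have hqp : ∀ t ∈ Icc 0 T, q t ≤ p t := le_of_hasDerivWithinAt_of_eq_imp_lt hqd hp hq0 htouch
  have hin : ∀ t ∈ Icc 0 T, ‖c t‖ ≤ ρ := fun t ht => by
    have h1 : ‖c t‖ ^ 2 ≤ ρ ^ 2 := by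
      rw [hρsq]; have := hP t ht; have := hqp t ht; simp only [hq] at this; linarith
    nlinarith [norm_nonneg (c t), hρpos]
  have hGeq : ∀ t ∈ Icc 0 T, G t (c t) = galerkinField 𝒯 A e t (c t) := fun t ht => by
    simp only [hG, projIcc_of_mem hT.le ht, hπ,
      ODE.ballRetraction_of_mem hρpos (show c t ∈ closedBall (0 : EuclideanSpace ℝ (Fin m)) ρ by
        simpa using hin t ht)]
  -- the Galerkin solution in `H`
  refine ⟨fun t => galerkinLift 𝒯 e (c t), ?_, ?_, ?_, ?_, ?_⟩
  · exact continuous_galerkinLift.comp_continuousOn fun t ht => (hcd t ht).continuousWithinAt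
  · simp only [hc0, hc₀, galerkinLift, PiLp.toLp_apply]
  · intro t ht
    rw [norm_galerkinLift_sq he]
    exact hqp t ht
  · intro t
    unfold galerkinLift
    refine Submodule.sum_mem _ fun i _ => Submodule.smul_mem _ _ (Submodule.subset_span ⟨i, rfl⟩)
  · intro i t ht
    have h1 : (fun s => ⟪𝒯.inclVH (e i), galerkinLift 𝒯 e (c s)⟫) = fun s => c s i :=
      funext fun s => inner_galerkinLift he (c s) i
    rw [h1]
    have h2 := hasDerivWithinAt_coord (hcd t ht) i
    rw [hGeq t ht] at h2
    simpa [galerkinField, PiLp.toLp_apply] using h2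

end Galerkin

end KatoLai

end Literature.Analysis.FluidPDE
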